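import Summits.CriticalPhenomena.PercolationContinuityZ3.Theorems.PercNearOneGluingNoHeavyLowerTailDisjointPockets
import HarnessLib

/-!
# `NoHeavyLowerTail` (stmt-CriticalPhenomena-4575) — CROSSING pockets: the full van den Berg–Kahn constraint

Support file (depth prover `nh-dp-blobmono`, respawn g5; `--supports stmt-CriticalPhenomena-4575`).
Bookkeeping only: no definitions, no named facts, no sorries.

Notation: `μ = prodBernoulli w` on `Fin n`, relays `A`, observer `o`, `π(o) = {a ∈ A : o ↔ a}`,
`g(U) = P(π(o) ⊆ U)` (the pocket distribution function of `…DisjointPockets.lean`; `g(U) = δ₀ + m(U)` with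
`δ₀ = P(o ↮ A)` and `m(U) = P(∅ ≠ π(o) ⊆ U)` the pocket mass, `pocketDF_eq_add_pocketMass`), and
`e(S) = P(π(o) = S ∩ A)` the mass of the single pocket `S`.

`…DisjointPockets.lean` records log-supermodularity `g(U₁)g(U₂) ≤ g(U₁ ∪ U₂)g(U₁ ∩ U₂)` (vdBK 2001) and
uses it for regions that are DISJOINT on `A` (`m(U₁)·m(U₂) ≤ δ₀`, "no two disjoint fat pockets"; lead memo
LEAD-GEN5 §4, constraint P5/P5′).  For OVERLAPPING regions the same inequality says strictly more, and this is
what the present file spells out: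

* `pocketDF_crossing` — the CROSSING FORM: with `I = S ∩ T`, `U = S ∪ T`,
  `(g S − g I)·(g T − g I) ≤ g I · (g U − g S − g T + g I)`.
  In pocket-mass terms: (mass of pockets inside `S` but not inside `S ∩ T`) × (same for `T`)
  `≤ (δ₀ + m(S ∩ T)) × (mass of BRIDGING pockets: inside `S ∪ T` but inside neither `S` nor `T`)`.
* `measureReal_pocketEq_le_pocketDF_sub` — a single pocket `S` with a relay outside `T` is charged to the
  left factor: `e(S) ≤ g S − g(S ∩ T)`.
* `pocketEq_mul_pocketEq_le_bridge` — hence for two pockets `S`, `T` that CROSS on `A` (each has a relay the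
  other lacks): **`e(S)·e(T) ≤ g(S ∩ T)·(g(S ∪ T) − g S − g T + g(S ∩ T))`**.
  Consequences (k-uniform, elementary): two crossing pockets of positive mass force BOTH `δ₀ + m(S ∩ T) > 0`
  AND a bridging pocket of positive mass inside `S ∪ T`; "rigid" crossing designs (crossing layers of blocks,
  cyclic arcs, projective-plane lines — any family in which the union of two crossing members contains no third
  member) carry NO pocket mass at all, and quantitatively a family of `M` pairwise-crossing pockets of mass `e`
  each, with pairwise intersections of mass `≤ x` and all bridges inside bad (small) unions, has
  `M(M−1)e² ≤ (δ₀ + x)·bad`.  This corrects LEAD-GEN5 §4 item (b) ("K crossing near-partitions … K → ∞ allowed"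
  used only the disjoint consequence of P5): crossing layers are excluded; what the pocket calculus does NOT
  exclude are positively-dependent "environment-mixture" smears (memo POCKET-CALCULUS-LIMITS.md of this seat,
  evidence on the item).
-/

noncomputable section

namespace Summit.CriticalPhenomena.PercolationContinuityZ3.Theorems

open MeasureTheory Set Literature.Probability.LatticeModels Literature.Probability.Percolation
open scoped Classical BigOperators

variable {n : ℕ}

/-- **Crossing form of the van den Berg–Kahn log-supermodularity of the pocket distribution function**:
`(g S − g(S∩T))·(g T − g(S∩T)) ≤ g(S∩T)·(g(S∪T) − g S − g T + g(S∩T))` — an algebraic rearrangement of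
`pocketDF_logSupermodular`. [this work; cite: VandenbergKahn2001, Thm. 1.2] -/
theorem pocketDF_crossing (w : Sym2 (Fin n) → unitInterval) (A S T : Finset (Fin n)) (o : Fin n) :
    ((prodBernoulli w).real {ω : BondConfig (Fin n) | ∀ a ∈ A, a ∉ S → ¬ (openGraph ω).Reachable o a} -
        (prodBernoulli w).real {ω : BondConfig (Fin n) | ∀ a ∈ A, a ∉ S ∩ T → ¬ (openGraph ω).Reachable o a}) *
      ((prodBernoulli w).real {ω : BondConfig (Fin n) | ∀ a ∈ A, a ∉ T → ¬ (openGraph ω).Reachable o a} -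
        (prodBernoulli w).real {ω : BondConfig (Fin n) | ∀ a ∈ A, a ∉ S ∩ T → ¬ (openGraph ω).Reachable o a}) ≤
    (prodBernoulli w).real {ω : BondConfig (Fin n) | ∀ a ∈ A, a ∉ S ∩ T → ¬ (openGraph ω).Reachable o a} *
      ((prodBernoulli w).real {ω : BondConfig (Fin n) | ∀ a ∈ A, a ∉ S ∪ T → ¬ (openGraph ω).Reachable o a} -
        (prodBernoulli w).real {ω : BondConfig (Fin n) | ∀ a ∈ A, a ∉ S → ¬ (openGraph ω).Reachable o a} -
        (prodBernoulli w).real {ω : BondConfig (Fin n) | ∀ a ∈ A, a ∉ T → ¬ (openGraph ω).Reachable o a} +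
        (prodBernoulli w).real {ω : BondConfig (Fin n) | ∀ a ∈ A, a ∉ S ∩ T → ¬ (openGraph ω).Reachable o a}) := by
  have key := pocketDF_logSupermodular w A S T o
  nlinarith [key]

/-- The single-pocket event `π(o) ∩ A = S ∩ A` lies inside `{π(o) ⊆ S}` and, as soon as `S` has a relay outside
`T`, is disjoint from `{π(o) ⊆ S ∩ T}`; hence `e(S) ≤ g S − g(S ∩ T)`. [this work] -/
theorem measureReal_pocketEq_le_pocketDF_sub (w : Sym2 (Fin n) → unitInterval) (A S T : Finset (Fin n)) (o : Fin n)
    (hS : ∃ a ∈ A, a ∈ S ∧ a ∉ T) :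
    (prodBernoulli w).real {ω : BondConfig (Fin n) | ∀ a ∈ A, (openGraph ω).Reachable o a ↔ a ∈ S} ≤
      (prodBernoulli w).real {ω : BondConfig (Fin n) | ∀ a ∈ A, a ∉ S → ¬ (openGraph ω).Reachable o a} -
        (prodBernoulli w).real {ω : BondConfig (Fin n) | ∀ a ∈ A, a ∉ S ∩ T → ¬ (openGraph ω).Reachable o a} := by
  set E : Set (BondConfig (Fin n)) := {ω | ∀ a ∈ A, (openGraph ω).Reachable o a ↔ a ∈ S} with hE
  set GS : Set (BondConfig (Fin n)) := {ω | ∀ a ∈ A, a ∉ S → ¬ (openGraph ω).Reachable o a} with hGS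
  set GI : Set (BondConfig (Fin n)) := {ω | ∀ a ∈ A, a ∉ S ∩ T → ¬ (openGraph ω).Reachable o a} with hGI
  have hEsub : E ⊆ GS \ GI := by
    intro ω hω
    refine ⟨fun a ha haS hr => haS ((hω a ha).1 hr), fun hGIω => ?_⟩
    obtain ⟨a, haA, haS, haT⟩ := hS
    have hr : (openGraph ω).Reachable o a := (hω a haA).2 haS
    exact hGIω a haA (by simp [Finset.mem_inter, haT]) hr
  have hGIsub : GI ⊆ GS := by
    intro ω hω a ha haS
    exact hω a ha (by simp [Finset.mem_inter, haS])
  calc (prodBernoulli w).real E ≤ (prodBernoulli w).real (GS \ GI) :=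
        measureReal_mono hEsub (measure_ne_top _ _)
    _ = (prodBernoulli w).real GS - (prodBernoulli w).real GI :=
        measureReal_sdiff hGIsub MeasurableSet.of_discrete (measure_ne_top _ _)

/-- **Two crossing pockets must be bridged.**  If `S` has a relay outside `T` and `T` has a relay outside `S`
then `e(S)·e(T) ≤ g(S∩T)·(g(S∪T) − g S − g T + g(S∩T))`, i.e. (with `g = δ₀ + m`)
`P(π(o)=S)·P(π(o)=T) ≤ (δ₀ + m(S∩T)) · (mass of pockets inside S ∪ T contained in neither S nor T)`.
In particular a pocket family in which no union of two crossing members contains a third member ("rigid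
crossing layers") carries no mass.  [this work; cite: VandenbergKahn2001, Thm. 1.2] -/
theorem pocketEq_mul_pocketEq_le_bridge (w : Sym2 (Fin n) → unitInterval) (A S T : Finset (Fin n)) (o : Fin n)
    (hS : ∃ a ∈ A, a ∈ S ∧ a ∉ T) (hT : ∃ a ∈ A, a ∈ T ∧ a ∉ S) :
    (prodBernoulli w).real {ω : BondConfig (Fin n) | ∀ a ∈ A, (openGraph ω).Reachable o a ↔ a ∈ S} *
      (prodBernoulli w).real {ω : BondConfig (Fin n) | ∀ a ∈ A, (openGraph ω).Reachable o a ↔ a ∈ T} ≤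
    (prodBernoulli w).real {ω : BondConfig (Fin n) | ∀ a ∈ A, a ∉ S ∩ T → ¬ (openGraph ω).Reachable o a} *
      ((prodBernoulli w).real {ω : BondConfig (Fin n) | ∀ a ∈ A, a ∉ S ∪ T → ¬ (openGraph ω).Reachable o a} -
        (prodBernoulli w).real {ω : BondConfig (Fin n) | ∀ a ∈ A, a ∉ S → ¬ (openGraph ω).Reachable o a} -
        (prodBernoulli w).real {ω : BondConfig (Fin n) | ∀ a ∈ A, a ∉ T → ¬ (openGraph ω).Reachable o a} +
        (prodBernoulli w).real {ω : BondConfig (Fin n) | ∀ a ∈ A, a ∉ S ∩ T → ¬ (openGraph ω).Reachable o a}) := by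
  have h1 := measureReal_pocketEq_le_pocketDF_sub w A S T o hS
  have h2' := measureReal_pocketEq_le_pocketDF_sub w A T S o hT
  have h2 : (prodBernoulli w).real {ω : BondConfig (Fin n) | ∀ a ∈ A, (openGraph ω).Reachable o a ↔ a ∈ T} ≤
      (prodBernoulli w).real {ω : BondConfig (Fin n) | ∀ a ∈ A, a ∉ T → ¬ (openGraph ω).Reachable o a} -
        (prodBernoulli w).real {ω : BondConfig (Fin n) | ∀ a ∈ A, a ∉ S ∩ T → ¬ (openGraph ω).Reachable o a} := by
    rw [Finset.inter_comm] at h2'; exact h2'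
  have hc := pocketDF_crossing w A S T o
  have e1 : 0 ≤ (prodBernoulli w).real {ω : BondConfig (Fin n) | ∀ a ∈ A, (openGraph ω).Reachable o a ↔ a ∈ S} :=
    measureReal_nonneg
  have e2 : 0 ≤ (prodBernoulli w).real {ω : BondConfig (Fin n) | ∀ a ∈ A, (openGraph ω).Reachable o a ↔ a ∈ T} :=
    measureReal_nonneg
  calc _ ≤ ((prodBernoulli w).real {ω : BondConfig (Fin n) | ∀ a ∈ A, a ∉ S → ¬ (openGraph ω).Reachable o a} -
        (prodBernoulli w).real {ω : BondConfig (Fin n) | ∀ a ∈ A, a ∉ S ∩ T → ¬ (openGraph ω).Reachable o a}) *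
      ((prodBernoulli w).real {ω : BondConfig (Fin n) | ∀ a ∈ A, a ∉ T → ¬ (openGraph ω).Reachable o a} -
        (prodBernoulli w).real {ω : BondConfig (Fin n) | ∀ a ∈ A, a ∉ S ∩ T → ¬ (openGraph ω).Reachable o a}) :=
        mul_le_mul h1 h2 e2 (le_trans e1 h1)
    _ ≤ _ := hc

end Summit.CriticalPhenomena.PercolationContinuityZ3.Theorems

end
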